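import Mathlib
import Literature.NumberTheory.Transcendental.GammaFields
import Literature.NumberTheory.Transcendental.PseudoExpVariants
import Literature.NumberTheory.Transcendental.ZilberGenericClosedness
import Summits.Schanuel.Schanuel.Theorems.RigidCoreAclSubsetLogFreeCoreDoubleModelTransport

/-!
# Stub `stub_doubleRank` (line `eac-extends-core-automorphisms`, crux stmt-Schanuel-0968)

**The predimension inequality `δ(D / j₁W) ≤ 0` for the double of a free strong extension**,
stated with the algebraic matroid of the abstract field `K` carrying the double.

Setting (produced by `stub_doubleBase`): `X = ℚτ + ℚc ◁ ℂ`, `W = X ⊕ ℚe` (`e` linearly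
independent over `X`, `δ(e/X) = 0`), a subfield `F ⊆ ℂ` containing `W` and `exp W`, a partial
exponential field `(K, D, θ, t)` (`IsStdKernelPartialExpField`) and two embeddings
`j₁ j₂ : F →+* K` ("two copies of `W`") with `jᵢ τ = t`, agreeing on `c`, with
`D = j₁W + j₂W` (`hD`) and `θ ∘ jᵢ = jᵢ ∘ exp` on `W` (`hθ`).  Writing `S₁ = span j₁(W)`, the
claim is

  `relRank (S₁ ∪ θ S₁) (D ∪ θ D) ≤ ldim (D / S₁)`.

Proof (refuter note `DrefuteG4StubDoubleModel.md`, verified here). Put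
`I₂ = {y ∈ W : j₂ y ∈ S₁}`, a `ℚ`-subspace with `X ≤ I₂ ≤ W` (the copies agree on the
generators `τ, c` of `X`).
* Linear dimension: `D = S₁ + S₂` with `S₂ = j₂(W) ≅ W` and `S₂ ∩ S₁ = j₂(I₂)`, so
  `ldim(D/S₁) = ldim(S₂/S₂ ∩ S₁) = ldim(W/I₂) = k - ldim(I₂/X)` (modularity `ldim_eq_ldim_inf`,
  invariance of `ldim` under the injective linear maps `j₂|_W` and `W ↪ ℂ`, `ldim_map_map`, and
  `ldim(W/X) = k` by linear independence of `e` over `X`).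
* Rank: `D ∪ θ D ⊆ acl (j₂(gens W) ∪ S₁ ∪ θ S₁)` (`θ` is a homomorphism on `D` and
  `θ (j₂ w) = j₂ (exp w)`), and `j₂ (gens I₂) ⊆ acl (S₁ ∪ θ S₁)` (for `y ∈ I₂`, `j₂ y ∈ S₁` and
  `j₂ (exp y) = θ (j₂ y) ∈ θ S₁`); hence
  `relRank (S₁ ∪ θ S₁) (D ∪ θ D) ≤ relRank (j₂ gens I₂) (j₂ gens W) = td(W/I₂)`
  (relative algebraic rank is invariant under the field embeddings `j₂ : F → K` and `F ⊆ ℂ`,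
  `relRank_image_image`).
* Predimension: `td(W/X) = ldim(W/X) = k` (`δ(W/X) = 0`), `td(W/X) = td(I₂/X) + td(W/I₂)`
  (`td_add`) and `td(I₂/X) ≥ ldim(I₂/X)` (`X ◁ ℂ`), so `td(W/I₂) ≤ k - ldim(I₂/X) = ldim(W/I₂)`.

Everything is elementary and fully proved. [folklore]
-/

noncomputable section

-- `Summit.Schanuel.Schanuel.…` is the single-problem-summit namespace by design (D-0017).
set_option linter.dupNamespace false

open Set
open Literature.ModelTheory.ExponentialFields Literature.ModelTheory.ExponentialFields.ExponentialRing
open Literature.NumberTheory.Transcendental Literature.NumberTheory.Transcendental.GammaField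

namespace Summit.Schanuel.Schanuel.Theorems.RigidCore

namespace DoubleRank

/-- `range (x ++ u) = range x ∪ range u` for `Fin.append`. [folklore] -/
theorem range_fin_append {α : Type*} {n k : ℕ} (x : Fin n → α) (u : Fin k → α) :
    range (Fin.append x u) = range x ∪ range u := by
  ext a
  constructor
  · rintro ⟨i, rfl⟩
    induction i using Fin.addCases with
    | left j => exact Or.inl ⟨j, by simp⟩
    | right j => exact Or.inr ⟨j, by simp⟩
  · rintro (⟨j, rfl⟩ | ⟨j, rfl⟩)
    · exact ⟨Fin.castAdd k j, Fin.append_left x u j⟩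
    · exact ⟨Fin.natAdd n j, Fin.append_right x u j⟩

/-- **The copy maps are `ℚ`-linear**: a field embedding `j : F →+* K` of a subfield `F ⊆ ℂ`
restricted to a `ℚ`-subspace `W ⊆ F` of `ℂ` is a `ℚ`-linear map `W →ₗ[ℚ] K`. [folklore] -/
theorem exists_linearMap (F : IntermediateField ℚ ℂ) {K : Type*} [Field K] [CharZero K]
    (j : F →+* K) {W : Submodule ℚ ℂ} (hWF : ∀ x ∈ W, x ∈ F) :
    ∃ u : W →ₗ[ℚ] K, ∀ w : W, u w = j ⟨w, hWF w w.2⟩ := by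
  let a : W →+ K :=
    { toFun := fun w => j ⟨w, hWF w w.2⟩
      map_zero' := by
        show j ⟨((0 : W) : ℂ), _⟩ = 0
        rw [← map_zero j]
        exact congrArg j (Subtype.ext (by simp))
      map_add' := fun a b => by
        show j ⟨((a + b : W) : ℂ), _⟩ = j ⟨(a : ℂ), _⟩ + j ⟨(b : ℂ), _⟩
        rw [← map_add j]
        exact congrArg j (Subtype.ext (by simp)) }
  exact ⟨a.toRatLinearMap, fun w => rfl⟩

/-- The span of `j '' {x : F | ↑x ∈ W}` (as in the stub) is the range of the linear map
`j|_W`. [folklore] -/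
theorem span_image_eq_range (F : IntermediateField ℚ ℂ) {K : Type*} [Field K] [CharZero K]
    (j : F →+* K) {W : Submodule ℚ ℂ} (hWF : ∀ x ∈ W, x ∈ F) (u : W →ₗ[ℚ] K)
    (hu : ∀ w : W, u w = j ⟨w, hWF w w.2⟩) :
    Submodule.span ℚ ((fun x : F => j x) '' {x : F | (x : ℂ) ∈ W}) = LinearMap.range u := by
  have h : (fun x : F => j x) '' {x : F | (x : ℂ) ∈ W} = Set.range u := by
    ext z
    constructor
    · rintro ⟨x, hx, rfl⟩
      exact ⟨⟨x, hx⟩, hu _⟩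
    · rintro ⟨w, rfl⟩
      exact ⟨⟨w, hWF w w.2⟩, w.2, (hu w).symm⟩
  rw [h, ← LinearMap.coe_range, Submodule.span_eq]

/-- **Core of the stub** (with `X = ℚτ + ℚc` and `W = X + ℚe` abbreviated): if `X ◁ ℂ`, `e` is
linearly independent over `X` with `δ(e/X) = 0`, `F ⊆ ℂ` contains `W ∪ exp W`,
`j₁ j₂ : F →+* K` send `τ ↦ t` and agree on `c`, `θ` is a homomorphism on `D = j₁W + j₂W`
(`IsStdKernelPartialExpField`) with `θ ∘ jᵢ = jᵢ ∘ exp` on `W`, then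
`relRank (S₁ ∪ θ S₁) (D ∪ θ D) ≤ ldim (D/S₁)` for `S₁ = span j₁(W)`; see the module docstring
for the proof. [folklore] -/
theorem relRank_le_ldim (τ : ℂ) {N k : ℕ} (c : Fin N → ℂ) (e : Fin k → ℂ)
    {X W : Submodule ℚ ℂ}
    (hXdef : X = Submodule.span ℚ ({τ} : Set ℂ) ⊔ Submodule.span ℚ (range c))
    (hWdef : W = X ⊔ Submodule.span ℚ (range e)) (hX : IsStrong X) (hlin : LinIndepOver X e)
    (hδ : predim X (Submodule.span ℚ (range e)) = 0) (F : IntermediateField ℚ ℂ)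
    (hWF : ∀ x ∈ W, x ∈ F) (hWE : ∀ x ∈ W, Complex.exp x ∈ F) {K : Type*} [Field K]
    [CharZero K] (D : Submodule ℚ K) (θ : K → K) (t : K) (j₁ j₂ : F →+* K)
    (hK : IsStdKernelPartialExpField K D θ t)
    (hjτ : ∀ hτF : τ ∈ F, j₁ ⟨τ, hτF⟩ = t ∧ j₂ ⟨τ, hτF⟩ = t)
    (hagree : ∀ (i : Fin N) (hcF : c i ∈ F), j₁ ⟨c i, hcF⟩ = j₂ ⟨c i, hcF⟩)
    (hD : D = Submodule.span ℚ
      ((fun x : F => j₁ x) '' {x : F | (x : ℂ) ∈ W} ∪ (fun x : F => j₂ x) '' {x : F | (x : ℂ) ∈ W}))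
    (hθ : ∀ (x : ℂ) (hxF : x ∈ F) (hexF : Complex.exp x ∈ F), x ∈ W →
      θ (j₁ ⟨x, hxF⟩) = j₁ ⟨Complex.exp x, hexF⟩ ∧ θ (j₂ ⟨x, hxF⟩) = j₂ ⟨Complex.exp x, hexF⟩) :
    (algMatroid K).relRank
        (↑(Submodule.span ℚ ((fun x : F => j₁ x) '' {x : F | (x : ℂ) ∈ W})) ∪
          θ '' ↑(Submodule.span ℚ ((fun x : F => j₁ x) '' {x : F | (x : ℂ) ∈ W})))
        (↑D ∪ θ '' ↑D) ≤
      ((ldim (Submodule.span ℚ ((fun x : F => j₁ x) '' {x : F | (x : ℂ) ∈ W})) D : ℕ) : ℕ∞) := by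
  classical
  -- `X ≤ W`, `W` finitely generated over `X`, `δ(W/X) = 0`, `ldim(W/X) = k`
  have hXW : X ≤ W := by rw [hWdef]; exact le_sup_left
  have hfgXW : IsFG X W := by
    rw [hWdef]; exact isFG_sup_left.2 (isFG_span_of_finite _ (finite_range e))
  have hδW : predim X W = 0 := by rw [hWdef, predim_sup_left]; exact hδ
  have hk : ldim X W = k := by
    rw [hWdef, ldim_sup_left, ldim, Submodule.map_span, ← Set.range_comp,
      finrank_span_eq_card ((linIndepOver_iff X e).1 hlin), Fintype.card_fin]
  have hτX : τ ∈ X := by rw [hXdef]; exact Submodule.mem_sup_left (Submodule.subset_span rfl)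
  have hcX : ∀ i, c i ∈ X := fun i => by
    rw [hXdef]; exact Submodule.mem_sup_right (Submodule.subset_span ⟨i, rfl⟩)
  -- the two copies as `ℚ`-linear maps `W → K`
  obtain ⟨u₁, hu₁⟩ := exists_linearMap F j₁ hWF
  obtain ⟨u₂, hu₂⟩ := exists_linearMap F j₂ hWF
  have hS₁ := span_image_eq_range F j₁ hWF u₁ hu₁
  have hS₂ := span_image_eq_range F j₂ hWF u₂ hu₂
  rw [Submodule.span_union, hS₁, hS₂] at hD
  rw [hS₁]
  set S₁ : Submodule ℚ K := LinearMap.range u₁ with hS₁def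
  set S₂ : Submodule ℚ K := LinearMap.range u₂ with hS₂def
  have hu₂inj : Function.Injective u₂ := by
    intro a b hab
    rw [hu₂, hu₂] at hab
    exact Subtype.ext (congrArg (fun y : F => (y : ℂ)) (j₂.injective hab))
  -- the subspace `I₂ = {y ∈ W : j₂ y ∈ S₁}`, inside `W` and inside `ℂ`
  set I₂W : Submodule ℚ W := S₁.comap u₂ with hI₂Wdef
  set I₂ : Submodule ℚ ℂ := I₂W.map W.subtype with hI₂def
  have hIW : I₂ ≤ W := Submodule.map_subtype_le W I₂W
  have hmemI : ∀ (x : ℂ) (hxW : x ∈ W), u₂ ⟨x, hxW⟩ = u₁ ⟨x, hxW⟩ → x ∈ I₂ := by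
    intro x hxW h12
    refine Submodule.mem_map.2 ⟨⟨x, hxW⟩, ?_, rfl⟩
    show u₂ ⟨x, hxW⟩ ∈ S₁
    rw [h12]
    exact LinearMap.mem_range_self u₁ _
  -- `X ≤ I₂`: the copies agree on the generators `τ`, `c` of `X`
  have hXI : X ≤ I₂ := by
    have hτF : τ ∈ F := hWF τ (hXW hτX)
    have hτI : τ ∈ I₂ := by
      refine hmemI τ (hXW hτX) ?_
      have e1 : u₁ ⟨τ, hXW hτX⟩ = t := by rw [hu₁]; exact (hjτ hτF).1
      have e2 : u₂ ⟨τ, hXW hτX⟩ = t := by rw [hu₂]; exact (hjτ hτF).2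
      rw [e1, e2]
    have hcI : ∀ i, c i ∈ I₂ := fun i => by
      refine hmemI (c i) (hXW (hcX i)) ?_
      rw [hu₁, hu₂]
      exact (hagree i _).symm
    rw [hXdef]
    exact sup_le (Submodule.span_le.2 (singleton_subset_iff.2 hτI))
      (Submodule.span_le.2 (range_subset_iff.2 hcI))
  -- (a) the linear dimension `ldim(D/S₁) = ldim(W/I₂)`
  have hldim : ldim S₁ D = ldim I₂ W := by
    have h1 : S₂ ⊓ S₁ = I₂W.map u₂ := (Submodule.map_comap_eq u₂ S₁).symm
    calc ldim S₁ D = ldim S₁ S₂ := by rw [hD, ldim_sup_left]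
      _ = ldim (S₂ ⊓ S₁) S₂ := ldim_eq_ldim_inf S₂ S₁
      _ = ldim I₂W (⊤ : Submodule ℚ W) := by
          rw [h1, hS₂def, ← Submodule.map_top, ldim_map_map u₂ hu₂inj]
      _ = ldim I₂ W := by
          rw [hI₂def, ← ldim_map_map W.subtype (Submodule.injective_subtype W) I₂W ⊤,
            Submodule.map_subtype_top]
  -- (b) `td(W/I₂) ≤ k - ldim(I₂/X) = ldim(W/I₂)`
  have htd : td I₂ W ≤ ((ldim I₂ W : ℕ) : ℕ∞) := by
    have hfgXI : IsFG X I₂ := hfgXW.mono hIW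
    have hfgIW : IsFG I₂ W := hfgXW.of_le_left hXI
    have hl : ldim X I₂ + ldim I₂ W = k := by rw [← ldim_add hXI hIW hfgXW, hk]
    have ht : (td X I₂).toNat + (td I₂ W).toNat = k := by
      have h := hδW
      rw [predim_def, td_add hXI hIW, ENat.toNat_add (td_ne_top hfgXI) (td_ne_top hfgIW),
        hk] at h
      omega
    have h0 : 0 ≤ predim X I₂ := hX hXI hfgXI
    rw [predim_def] at h0
    have hnat : (td I₂ W).toNat ≤ ldim I₂ W := by omega
    rw [← ENat.coe_toNat (td_ne_top hfgIW)]
    exact_mod_cast hnat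
  -- (c) the rank estimate inside `K`
  set G₁ : Set K := (↑S₁ ∪ θ '' ↑S₁) with hG₁def
  set GW : Set F := {y : F | (y : ℂ) ∈ gens W} with hGWdef
  set GI : Set F := {y : F | (y : ℂ) ∈ gens I₂} with hGIdef
  have hS₁D : S₁ ≤ D := by rw [hD]; exact le_sup_left
  have hS₂D : S₂ ≤ D := by rw [hD]; exact le_sup_right
  have hDmem : ∀ d ∈ D, ∃ s ∈ S₁, ∃ w : W, d = s + u₂ w := by
    intro d hd
    rw [hD] at hd
    obtain ⟨s, hs, r, hr, rfl⟩ := Submodule.mem_sup.1 hd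
    obtain ⟨w, rfl⟩ := LinearMap.mem_range.1 hr
    exact ⟨s, hs, w, rfl⟩
  have hθu₂ : ∀ w : W, θ (u₂ w) = j₂ ⟨Complex.exp w, hWE _ w.2⟩ := fun w => by
    rw [hu₂]
    exact (hθ _ (hWF _ w.2) (hWE _ w.2) w.2).2
  have hA : (↑D ∪ θ '' ↑D : Set K) ⊆ acl (j₂ '' GW ∪ G₁) := by
    rintro z (hz | ⟨d, hd, rfl⟩)
    · obtain ⟨s, hs, w, rfl⟩ := hDmem z hz
      refine add_mem_acl (subset_acl _ (Or.inr (Or.inl hs))) (subset_acl _ (Or.inl ?_))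
      exact ⟨⟨w, hWF _ w.2⟩, mem_gens_of_mem w.2, (hu₂ w).symm⟩
    · obtain ⟨s, hs, w, rfl⟩ := hDmem d hd
      rw [hK.map_add (hS₁D hs) (hS₂D (LinearMap.mem_range_self u₂ w))]
      refine mul_mem_acl (subset_acl _ (Or.inr (Or.inr ⟨s, hs, rfl⟩))) (subset_acl _ (Or.inl ?_))
      rw [hθu₂ w]
      exact ⟨⟨Complex.exp w, hWE _ w.2⟩, exp_mem_gens w.2, rfl⟩
  have hB : j₂ '' GI ⊆ acl G₁ := by
    rintro _ ⟨y, hy, rfl⟩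
    have hy' : (y : ℂ) ∈ gens I₂ := hy
    rcases hy' with hyI | ⟨x, hxI, hxy⟩
    · have hyI' : (y : ℂ) ∈ I₂ := hyI
      rw [hI₂def, Submodule.mem_map] at hyI'
      obtain ⟨w, hw, hwy⟩ := hyI'
      have hyw : y = ⟨(w : ℂ), hWF _ w.2⟩ := Subtype.ext hwy.symm
      refine subset_acl _ (Or.inl ?_)
      rw [hyw, ← hu₂ w]
      exact hw
    · have hxI' : x ∈ I₂ := hxI
      rw [hI₂def, Submodule.mem_map] at hxI'
      obtain ⟨w, hw, rfl⟩ := hxI'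
      have hyw : y = ⟨Complex.exp (w : ℂ), hWE _ w.2⟩ := Subtype.ext hxy.symm
      refine subset_acl _ (Or.inr ⟨u₂ w, hw, ?_⟩)
      rw [hyw, hθu₂ w]
  have hgensF : gens W ⊆ (F : Set ℂ) := by
    rintro z (hz | ⟨w, hw, rfl⟩)
    · exact hWF z hz
    · exact hWE w hw
  have himgW : (algebraMap F ℂ) '' GW = gens W := by
    ext z
    constructor
    · rintro ⟨y, hy, rfl⟩
      exact hy
    · intro hz
      exact ⟨⟨z, hgensF hz⟩, hz, rfl⟩
  have himgI : (algebraMap F ℂ) '' GI = gens I₂ := by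
    ext z
    constructor
    · rintro ⟨y, hy, rfl⟩
      exact hy
    · intro hz
      exact ⟨⟨z, hgensF (gens_mono hIW hz)⟩, hz, rfl⟩
  have hKC : (algMatroid K).relRank (j₂ '' GI) (j₂ '' GW) = td I₂ W := by
    rw [relRank_image_image, ← relRank_image_image (algebraMap F ℂ), himgI, himgW, td_def]
  calc (algMatroid K).relRank G₁ (↑D ∪ θ '' ↑D)
      ≤ (algMatroid K).relRank G₁ (j₂ '' GW) := (algMatroid K).relRank_le_of_subset_closure _ hA
    _ = (algMatroid K).relRank ((algMatroid K).closure G₁) (j₂ '' GW) :=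
        ((algMatroid K).relRank_closure_left _ _).symm
    _ ≤ (algMatroid K).relRank (j₂ '' GI) (j₂ '' GW) := (algMatroid K).relRank_anti_left _ hB
    _ = td I₂ W := hKC
    _ ≤ ((ldim I₂ W : ℕ) : ℕ∞) := htd
    _ = ((ldim S₁ D : ℕ) : ℕ∞) := by rw [hldim]

end DoubleRank

/-- **Stub `stub_doubleRank` — the predimension inequality `δ(D / j₁W) ≤ 0` inside the double.**
For `X = ℚτ + ℚc ◁ ℂ` and `W = X ⊕ ℚe` with `δ(e/X) = 0`, a subfield `F ⊆ ℂ` containing `W` and its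
division points, a partial exponential field `(K, D, θ, t)` with standard kernel and two copies
`j₁ j₂ : F →+* K` of `W` sending `τ ↦ t` and agreeing on `X` and on `exp (X/M!)`, with
`D = j₁W + j₂W` and `θ ∘ jᵢ = jᵢ ∘ exp` on `W`: the relative algebraic rank of `D ∪ θ D` over
`S₁ ∪ θ S₁`, `S₁ = span j₁(W)`, is at most `ldim(D/S₁)`.  Proof: `DoubleRank.relRank_le_ldim` with
`I₂ = {y ∈ W : j₂ y ∈ S₁} ⊇ X`: `ldim(D/S₁) = ldim(W/I₂) = k - ldim(I₂/X) ≥ td(W/I₂)` because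
`td(W/X) = k` (`δ(W/X) = 0`) and `td(I₂/X) ≥ ldim(I₂/X)` (`X ◁ ℂ`), and `td(W/I₂)` bounds the
rank since `j₂(gens I₂) ⊆ acl (S₁ ∪ θ S₁)` and `D ∪ θ D ⊆ acl (j₂ (gens W) ∪ S₁ ∪ θ S₁)`. -/
theorem stub_doubleRank (τ : ℂ) {N k : ℕ} (c : Fin N → ℂ) (e : Fin k → ℂ)
    (hX : IsStrong (Submodule.span ℚ ({τ} : Set ℂ) ⊔ Submodule.span ℚ (range c)))
    (hlin : LinIndepOver (Submodule.span ℚ ({τ} : Set ℂ) ⊔ Submodule.span ℚ (range c)) e)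
    (hδ : predim (Submodule.span ℚ ({τ} : Set ℂ) ⊔ Submodule.span ℚ (range c))
      (Submodule.span ℚ (range e)) = 0)
    (F : IntermediateField ℚ ℂ)
    (hFW : ∀ x ∈ Submodule.span ℚ ({τ} : Set ℂ) ⊔ Submodule.span ℚ (range (Fin.append c e)),
      x ∈ F ∧ ∀ M : ℕ, Complex.exp (x / (M.factorial : ℂ)) ∈ F)
    (K : Type) [Field K] [CharZero K] (D : Submodule ℚ K) (θ : K → K) (t : K) (j₁ j₂ : F →+* K)
    (hK : IsStdKernelPartialExpField K D θ t)
    (hjτ : ∀ hτF : τ ∈ F, j₁ ⟨τ, hτF⟩ = t ∧ j₂ ⟨τ, hτF⟩ = t)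
    (hagree : ∀ (x : ℂ) (hxF : x ∈ F),
      (x ∈ Submodule.span ℚ ({τ} : Set ℂ) ⊔ Submodule.span ℚ (range c) ∨
        ∃ y ∈ Submodule.span ℚ ({τ} : Set ℂ) ⊔ Submodule.span ℚ (range c), ∃ M : ℕ,
          x = Complex.exp (y / (M.factorial : ℂ))) →
      j₁ ⟨x, hxF⟩ = j₂ ⟨x, hxF⟩)
    (hD : D = Submodule.span ℚ
      ((fun x : F => j₁ x) '' {x : F | (x : ℂ) ∈ Submodule.span ℚ ({τ} : Set ℂ) ⊔
          Submodule.span ℚ (range (Fin.append c e))} ∪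
        (fun x : F => j₂ x) '' {x : F | (x : ℂ) ∈ Submodule.span ℚ ({τ} : Set ℂ) ⊔
          Submodule.span ℚ (range (Fin.append c e))}))
    (hθ : ∀ (x : ℂ) (hxF : x ∈ F) (hexF : Complex.exp x ∈ F),
      x ∈ Submodule.span ℚ ({τ} : Set ℂ) ⊔ Submodule.span ℚ (range (Fin.append c e)) →
      θ (j₁ ⟨x, hxF⟩) = j₁ ⟨Complex.exp x, hexF⟩ ∧ θ (j₂ ⟨x, hxF⟩) = j₂ ⟨Complex.exp x, hexF⟩) :
    (algMatroid K).relRank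
        (↑(Submodule.span ℚ ((fun x : F => j₁ x) '' {x : F | (x : ℂ) ∈ Submodule.span ℚ ({τ} : Set ℂ) ⊔
          Submodule.span ℚ (range (Fin.append c e))})) ∪
          θ '' ↑(Submodule.span ℚ ((fun x : F => j₁ x) '' {x : F | (x : ℂ) ∈
            Submodule.span ℚ ({τ} : Set ℂ) ⊔ Submodule.span ℚ (range (Fin.append c e))})))
        (↑D ∪ θ '' ↑D) ≤
      ((ldim (Submodule.span ℚ ((fun x : F => j₁ x) '' {x : F | (x : ℂ) ∈ Submodule.span ℚ ({τ} : Set ℂ) ⊔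
          Submodule.span ℚ (range (Fin.append c e))})) D : ℕ) : ℕ∞) := by
  -- `W = X ⊕ ℚe`
  have hWeq : (Submodule.span ℚ ({τ} : Set ℂ) ⊔ Submodule.span ℚ (range (Fin.append c e))) =
      (Submodule.span ℚ ({τ} : Set ℂ) ⊔ Submodule.span ℚ (range c)) ⊔
        Submodule.span ℚ (range e) := by
    rw [DoubleRank.range_fin_append, Submodule.span_union, sup_assoc]
  exact DoubleRank.relRank_le_ldim τ c e rfl hWeq hX hlin hδ F (fun x hx => (hFW x hx).1)
    (fun x hx => by simpa using (hFW x hx).2 0) D θ t j₁ j₂ hK hjτ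
    (fun i hcF => hagree (c i) hcF
      (Or.inl (Submodule.mem_sup_right (Submodule.subset_span ⟨i, rfl⟩))))
    hD hθ

end Summit.Schanuel.Schanuel.Theorems.RigidCore
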